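import Literature.Probability.RandomPlanarGeometry.HexSAWStripSurfaceArchCut
import HarnessLib

/-!
# Zig-zag bridges along the surface: `B_{T,L}(x_c, y)` is unbounded in `L` for `y > 2 + √2`
# (face UB′ of the door «HEX-YC-DCS»: BBdGDCG 2014, proof of Proposition 5)

Topic `Literature/Probability/RandomPlanarGeometry` (continues `HexSAWStripSurfaceArchCut.lean` — the surface-weighted
class generating functions `HV.stripGFy T L cls y` of the Duminil-Copin–Smirnov strips `S_{T,L}` = `HV.stripV T L`, contacts
`HV.surfContacts`).  Source: N. R. Beaton, M. Bousquet-Mélou, J. de Gier, H. Duminil-Copin, A. J. Guttmann, *The critical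
fugacity for surface adsorption of self-avoiding walks on the honeycomb lattice is `1 + √2`*, Comm. Math. Phys. 326 (2014)
727–754, arXiv:1109.0358v5, proof of Proposition 5 (p. 9): "the second [bound, `μ(y) ≥ √y`] is obtained by counting zig-zag
walks sticking to the surface" — one surface contact for every two vertices, so the walk weight at `(x_c, y)` grows like
`(x_c² y)^{L}` and `x_c⁻² = 2 + √2`.

## What is proved (HOME build of a-p2 g7, 2026-08-23; face UB′ `StripByUnboundedLarge` of a-idea-1 gen 17's door R96′)

* `zzV T n` — the `n`-th vertex of the zig-zag bridge of `S_{T,L}`: the column above the origin up to the surface level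
  `2T − 1`, then the zig-zag `(i, T−1, false), (i, T−1, true)`, `1 ≤ i ≤ k`, along the surface; `zzInner`, `zzWalk T k` — the
  mid-edge walk it defines, exiting through the `β` mid-edge above `(k, T−1, true)`; `zzV_adj`, `zzV_mem_stripV`, `zzV_injective`;
* `zzWalk_mem` — for `T ≥ 1`, `k ≤ L` it is a `β`-walk of `S_{T,L}`; `mwLen_zzWalk` (`= 2T + 2k`) and `le_surfContacts_zzWalk`
  (at least `k` surface contacts); `zzP`, `zzP_adj_ft`, `zzP_adj_tf`, `lev_zzV_of_odd`;
* `pow_le_stripGFy_beta` — `x_c^{2T} (x_c² y)^L ≤ B_{T,L}(x_c, y)` for `y ≥ 1`;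
* **`stripGFy_beta_not_bddAbove`** — for `T ≥ 1` and `y > 2 + √2`, `L ↦ B_{T,L}(x_c, y)` is unbounded; the face
  **`StripByUnboundedLarge`** (a-idea-1 gen 17, Sketch_G17 l. 926, verbatim) with `stripByUnboundedLarge_holds`.
-/

noncomputable section

open Finset Filter Topology Literature.Probability.LatticeModels Literature.Probability.Percolation

namespace Literature.Probability.RandomPlanarGeometry.SAW.HV

/-! ### The zig-zag bridge -/

/-- The zig-zag vertex with height parameter `h` and type `b`: `x₁ = min(h, T − 1)`, `x₀ = h − x₁` (the column above the origin for
`h < T`, the surface stretch for `h ≥ T − 1`). [cite: BeatonBousquetMelouDeGierDuminilCopinGuttmann2014, proof of Proposition 5 (arXiv v5 p. 9: "zig-zag walks sticking to the surface")] -/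
def zzP (T h : ℕ) (b : Bool) : HV := ((h : ℤ) - min (h : ℤ) ((T : ℤ) - 1), min (h : ℤ) ((T : ℤ) - 1), b)

/-- The `n`-th inner vertex of the zig-zag bridge in `S_T`: `zzP T ⌊n/2⌋ (n odd)` (so the level is `n` on the column `n < 2T` and
`2T − 2 + (n mod 2)` along the surface). [cite: BeatonBousquetMelouDeGierDuminilCopinGuttmann2014, proof of Proposition 5 (arXiv v5 p. 9)] -/
def zzV (T n : ℕ) : HV := zzP T (n / 2) (decide (n % 2 = 1))

/-- The inner vertex list of the zig-zag bridge with `k` zig-zag steps: `2T + 2k` vertices.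
[cite: BeatonBousquetMelouDeGierDuminilCopinGuttmann2014, proof of Proposition 5 (arXiv v5 p. 9)] -/
def zzInner (T k : ℕ) : List HV := (List.range (2 * T + 2 * k)).map (zzV T)

/-- The zig-zag bridge as a mid-edge walk list `w :: inner ++ [exit]`, exiting upwards from `(k, T − 1, true)`.
[cite: BeatonBousquetMelouDeGierDuminilCopinGuttmann2014, proof of Proposition 5 (arXiv v5 p. 9)] -/
def zzWalk (T k : ℕ) : List HV := wOut :: (zzInner T k ++ [((k : ℤ), (T : ℤ), false)])

/-- Within a cell: the up triangle below the down triangle (honeycomb adjacency along the zig-zag).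
[cite: BeatonBousquetMelouDeGierDuminilCopinGuttmann2014, proof of Proposition 5 (arXiv v5 p. 9: zig-zag walks sticking to the surface); §2 (the lattice)] -/
theorem zzP_adj_ft (T h : ℕ) : hvGraph.Adj (zzP T h false) (zzP T h true) := by
  rw [hvGraph_adj]; left; simp [zzP]

/-- From a down triangle to the next cell (up the column, or one step right along the surface).
[cite: BeatonBousquetMelouDeGierDuminilCopinGuttmann2014, proof of Proposition 5 (arXiv v5 p. 9: zig-zag walks sticking to the surface); §2 (the lattice)] -/
theorem zzP_adj_tf (T h : ℕ) : hvGraph.Adj (zzP T h true) (zzP T (h + 1) false) := by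
  rw [hvGraph_adj]; right
  simp only [zzP, true_and, Nat.cast_add, Nat.cast_one]
  omega

/-- Consecutive zig-zag vertices are adjacent. [cite: BeatonBousquetMelouDeGierDuminilCopinGuttmann2014, proof of Proposition 5] -/
theorem zzV_adj (T n : ℕ) : hvGraph.Adj (zzV T n) (zzV T (n + 1)) := by
  rcases Nat.mod_two_eq_zero_or_one n with hn | hn
  · have h1 : (n + 1) % 2 = 1 := by omega
    have h2 : (n + 1) / 2 = n / 2 := by omega
    have hn' : ¬ (n % 2 = 1) := by omega
    rw [zzV, zzV, h2]
    simp only [hn', h1, decide_false, decide_true]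
    exact zzP_adj_ft T _
  · have h1 : ¬ ((n + 1) % 2 = 1) := by omega
    have h2 : (n + 1) / 2 = n / 2 + 1 := by omega
    rw [zzV, zzV, h2]
    simp only [hn, h1, decide_false, decide_true]
    exact zzP_adj_tf T _

/-- The first zig-zag vertex is the origin. [cite: BeatonBousquetMelouDeGierDuminilCopinGuttmann2014, proof of Proposition 5] -/
theorem zzV_zero {T : ℕ} (hT : 1 ≤ T) : zzV T 0 = hvOrigin := by
  rw [zzV, Nat.zero_div, hvOrigin]
  simp only [zzP, Nat.zero_mod, zero_ne_one, decide_false, Nat.cast_zero, Prod.mk.injEq, and_true]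
  omega

/-- The last zig-zag vertex is `(k, T − 1, true)`. [cite: BeatonBousquetMelouDeGierDuminilCopinGuttmann2014, proof of Proposition 5] -/
theorem zzV_last {T : ℕ} (hT : 1 ≤ T) (k : ℕ) : zzV T (2 * T + 2 * k - 1) = ((k : ℤ), (T : ℤ) - 1, true) := by
  have h1 : (2 * T + 2 * k - 1) % 2 = 1 := by omega
  have h2 : (2 * T + 2 * k - 1) / 2 = T + k - 1 := by omega
  rw [zzV, h2]
  simp only [zzP, h1, decide_true, Prod.mk.injEq, and_true]
  omega

/-- The second-to-last zig-zag vertex is `(k, T − 1, false)`. [cite: BeatonBousquetMelouDeGierDuminilCopinGuttmann2014, proof of Proposition 5] -/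
theorem zzV_prev {T : ℕ} (hT : 1 ≤ T) (k : ℕ) : zzV T (2 * T + 2 * k - 2) = ((k : ℤ), (T : ℤ) - 1, false) := by
  have h1 : ¬ ((2 * T + 2 * k - 2) % 2 = 1) := by omega
  have h2 : (2 * T + 2 * k - 2) / 2 = T + k - 1 := by omega
  rw [zzV, h2]
  simp only [zzP, h1, decide_false, Prod.mk.injEq, and_true]
  omega

/-- Every zig-zag vertex lies in `S_{T,L}` when `k ≤ L`. [cite: BeatonBousquetMelouDeGierDuminilCopinGuttmann2014, proof of Proposition 5] -/
theorem zzV_mem_stripV {T L k n : ℕ} (hT : 1 ≤ T) (hk : k ≤ L) (hn : n < 2 * T + 2 * k) : zzV T n ∈ stripV T L := by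
  rw [mem_stripV_iff, zzV]
  rcases Nat.mod_two_eq_zero_or_one n with hp | hp
  · have hp' : ¬ (n % 2 = 1) := by omega
    simp only [zzP, hp', decide_false, lev_mk, bit_false]
    omega
  · simp only [zzP, hp, decide_true, lev_mk, bit_true]
    omega

/-- The zig-zag vertices are pairwise distinct. [cite: BeatonBousquetMelouDeGierDuminilCopinGuttmann2014, proof of Proposition 5] -/
theorem zzV_injective (T : ℕ) : Function.Injective (zzV T) := by
  intro m n h
  simp only [zzV, zzP, Prod.mk.injEq, decide_eq_decide] at h
  omega

/-- On the surface stretch, the odd-indexed vertices are contacts (level `2T − 1`).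
[cite: BeatonBousquetMelouDeGierDuminilCopinGuttmann2014, proof of Proposition 5 ("sticking to the surface")] -/
theorem lev_zzV_of_odd {T n : ℕ} (hT : 2 * T ≤ n) (hn : n % 2 = 1) : lev (zzV T n) = 2 * (T : ℤ) - 1 := by
  simp only [zzV, zzP, hn, decide_true, lev_mk, bit_true]
  omega

/-- The walk has `2T + 2k` inner vertices. [cite: BeatonBousquetMelouDeGierDuminilCopinGuttmann2014, proof of Proposition 5] -/
theorem mwLen_zzWalk (T k : ℕ) : mwLen (zzWalk T k) = 2 * T + 2 * k := by
  simp [mwLen, zzWalk, zzInner]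

/-- The number of odd indices `n` with `2T ≤ n < 2T + 2k` is `k` (the zig-zag walk with `k` surface steps has `k` surface contacts).
[cite: BeatonBousquetMelouDeGierDuminilCopinGuttmann2014, proof of Proposition 5 (arXiv v5 p. 9: counting zig-zag walks, weight √y per step)] -/
theorem countP_surface_range (T k : ℕ) :
    (List.range (2 * T + 2 * k)).countP (fun n => 2 * T ≤ n ∧ n % 2 = 1) = k := by
  induction k with
  | zero =>
    rw [List.countP_eq_zero]
    intro n hn
    rw [List.mem_range] at hn
    simp only [decide_eq_true_eq, not_and]
    omega
  | succ k ih =>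
    have e2 : 2 * T ≤ 2 * T + 2 * k + 1 ∧ (2 * T + 2 * k + 1) % 2 = 1 := by omega
    rw [show 2 * T + 2 * (k + 1) = 2 * T + 2 * k + 1 + 1 by ring, List.range_succ, List.range_succ,
      List.countP_append, List.countP_append, ih]
    simp [e2]

/-- The zig-zag bridge with `k` steps has at least `k` surface contacts.
[cite: BeatonBousquetMelouDeGierDuminilCopinGuttmann2014, proof of Proposition 5 (arXiv v5 p. 9)] -/
theorem le_surfContacts_zzWalk (T k : ℕ) : k ≤ surfContacts T (zzWalk T k) := by
  rw [zzWalk, surfContacts_cons_append, ← List.countP_eq_length_filter, zzInner, List.countP_map]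
  calc k = (List.range (2 * T + 2 * k)).countP (fun n => 2 * T ≤ n ∧ n % 2 = 1) := (countP_surface_range T k).symm
    _ ≤ _ := by
      refine List.countP_mono_left fun n _ hn => ?_
      simp only [decide_eq_true_eq] at hn
      simp only [Function.comp_apply, decide_eq_true_eq]
      exact lev_zzV_of_odd hn.1 hn.2

/-- The final dart of the zig-zag bridge: from `(k, T−1, true)` straight up.
[cite: BeatonBousquetMelouDeGierDuminilCopinGuttmann2014, proof of Proposition 5] -/
theorem finalDart_zzWalk {T : ℕ} (hT : 1 ≤ T) (k : ℕ) :
    finalDart (zzWalk T k) = (((k : ℤ), (T : ℤ) - 1, true), ((k : ℤ), (T : ℤ), false)) := by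
  obtain ⟨N, hNdef⟩ : ∃ N, 2 * T + 2 * k = N + 1 := ⟨2 * T + 2 * k - 1, by omega⟩
  have hl : (zzInner T k).getLast? = some (((k : ℤ), (T : ℤ) - 1, true)) := by
    rw [zzInner, hNdef, List.range_succ, List.map_append, ← zzV_last hT k, show 2 * T + 2 * k - 1 = N by omega]
    simp
  rw [finalDart, zzWalk, ← List.cons_append, List.dropLast_concat, List.getLast?_concat, List.getLast?_cons, hl]
  simp

/-- **The zig-zag bridge is a `β`-walk of `S_{T,L}`** (`T ≥ 1`, `k ≤ L`).
[cite: BeatonBousquetMelouDeGierDuminilCopinGuttmann2014, proof of Proposition 5 (arXiv v5 p. 9)] -/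
theorem zzWalk_mem {T L k : ℕ} (hT : 1 ≤ T) (hk : k ≤ L) :
    zzWalk T k ∈ (midWalks (stripV T L)).filter fun P => IsBetaDart T (finalDart P) := by
  obtain ⟨N, hNdef⟩ : ∃ N, 2 * T + 2 * k = N + 2 := ⟨2 * T + 2 * k - 2, by omega⟩
  have hsplit : zzInner T k = ((List.range N).map (zzV T) ++ [zzV T N]) ++ [zzV T (N + 1)] := by
    rw [zzInner, hNdef, List.range_succ, List.range_succ, List.map_append, List.map_append]
    rfl
  have hne : zzInner T k ≠ [] := by rw [hsplit]; simp
  have hlastN : zzV T (N + 1) = ((k : ℤ), (T : ℤ) - 1, true) := by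
    rw [show N + 1 = 2 * T + 2 * k - 1 by omega]; exact zzV_last hT k
  have hprevN : zzV T N = ((k : ℤ), (T : ℤ) - 1, false) := by
    rw [show N = 2 * T + 2 * k - 2 by omega]; exact zzV_prev hT k
  have hlast : (zzInner T k).getLast hne = ((k : ℤ), (T : ℤ) - 1, true) := by
    apply Option.some_injective _
    rw [← List.getLast?_eq_some_getLast hne, hsplit, List.getLast?_concat, hlastN]
  have hdl : (zzInner T k).dropLast = (List.range N).map (zzV T) ++ [zzV T N] := by
    rw [hsplit, List.dropLast_concat]
  have hprev : prevOf (zzInner T k) = ((k : ℤ), (T : ℤ) - 1, false) := by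
    apply Option.some_injective _
    rw [prevOf, ← List.getLast?_eq_some_getLast, hdl, ← List.cons_append, List.getLast?_concat, hprevN]
  rw [mem_filter, mem_midWalks_iff]
  refine ⟨?_, ?_⟩
  · rw [zzWalk, isMidWalk_cons_append_iff _ hne]
    refine ⟨?_, ?_, ?_, ?_, ?_, ?_⟩
    · rw [zzInner, List.isChain_map, hNdef, List.isChain_range_succ]
      exact fun m _ => zzV_adj T m
    · rw [zzInner, hNdef, List.range_succ_eq_map]
      simp [zzV_zero hT]
    · rw [hlast, hvGraph_adj]
      simp [AdjRel]
    · intro x hx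
      rw [zzInner, List.mem_map] at hx
      obtain ⟨n, hn, rfl⟩ := hx
      exact zzV_mem_stripV hT hk (List.mem_range.1 hn)
    · exact List.nodup_range.map (zzV_injective T)
    · rw [hprev, Ne, Prod.mk.injEq, Prod.mk.injEq]
      omega
  · rw [finalDart_zzWalk hT]
    refine ⟨rfl, rfl, ?_⟩
    simp

/-! ### The lower bound and the unboundedness -/

/-- **`x_c^{2T} (x_c² y)^L ≤ B_{T,L}(x_c, y)`** for `T ≥ 1`, `y ≥ 1`: the single zig-zag bridge with `L` steps.
[cite: BeatonBousquetMelouDeGierDuminilCopinGuttmann2014, proof of Proposition 5 (arXiv v5 p. 9: weight of the zig-zag walks)] -/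
theorem pow_le_stripGFy_beta {T : ℕ} (hT : 1 ≤ T) (L : ℕ) {y : ℝ} (hy : 1 ≤ y) :
    hexCriticalFugacity ^ (2 * T) * (hexCriticalFugacity ^ 2 * y) ^ L ≤ stripGFy T L (IsBetaDart T) y := by
  have hx : 0 < hexCriticalFugacity := hexCriticalFugacity_pos_lt_one.1
  have hmem := zzWalk_mem hT (le_refl L)
  calc hexCriticalFugacity ^ (2 * T) * (hexCriticalFugacity ^ 2 * y) ^ L
      = hexCriticalFugacity ^ (2 * T + 2 * L) * y ^ L := by ring
    _ ≤ hexCriticalFugacity ^ mwLen (zzWalk T L) * y ^ surfContacts T (zzWalk T L) := by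
        rw [mwLen_zzWalk]
        exact mul_le_mul_of_nonneg_left (pow_le_pow_right₀ hy (le_surfContacts_zzWalk T L)) (by positivity)
    _ ≤ stripGFy T L (IsBetaDart T) y := by
        rw [stripGFy]
        exact single_le_sum (f := fun P => hexCriticalFugacity ^ mwLen P * y ^ surfContacts T P)
          (fun _ _ => by positivity) hmem

/-- `x_c² y > 1` for `y > 2 + √2` (`x_c² (2 + √2) = 1`). [cite: BeatonBousquetMelouDeGierDuminilCopinGuttmann2014, §1 (x_c = 1/√(2+√2))] -/
theorem one_lt_hexCriticalFugacity_sq_mul {y : ℝ} (hy : 2 + Real.sqrt 2 < y) : 1 < hexCriticalFugacity ^ 2 * y := by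
  have h := hexCriticalFugacity_sq
  have hx2 : 0 < hexCriticalFugacity ^ 2 := by have := hexCriticalFugacity_pos_lt_one.1; positivity
  nlinarith

/-- **`B_{T,L}(x_c, y)` is unbounded in `L` for `T ≥ 1` and `y > 2 + √2`.**
[cite: BeatonBousquetMelouDeGierDuminilCopinGuttmann2014, proof of Proposition 5 (arXiv v5 p. 9: "μ(y) ≥ √y … by counting zig-zag walks sticking to the surface")] -/
theorem stripGFy_beta_not_bddAbove {T : ℕ} (hT : 1 ≤ T) {y : ℝ} (hy : 2 + Real.sqrt 2 < y) :
    ¬ BddAbove (Set.range fun L : ℕ => stripGFy T L (IsBetaDart T) y) := by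
  rintro ⟨K, hK⟩
  have hx : 0 < hexCriticalFugacity := hexCriticalFugacity_pos_lt_one.1
  have hy1 : 1 ≤ y := by have := Real.sqrt_nonneg 2; linarith
  have hq := one_lt_hexCriticalFugacity_sq_mul hy
  have ht : Tendsto (fun L : ℕ => hexCriticalFugacity ^ (2 * T) * (hexCriticalFugacity ^ 2 * y) ^ L) atTop atTop :=
    Tendsto.const_mul_atTop (by positivity) (tendsto_pow_atTop_atTop_of_one_lt hq)
  obtain ⟨L, hL⟩ := (ht.eventually_gt_atTop K).exists
  have h1 : stripGFy T L (IsBetaDart T) y ≤ K := hK ⟨L, rfl⟩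
  have h2 := pow_le_stripGFy_beta hT L hy1
  linarith

/-- **Face UB′ «ZIGZAG-SURFACE»** of the door R96′ «HEX-YC-DCS» (a-idea-1 gen 17, Sketch_G17 l. 926, verbatim): above
`2 + √2 = x_c⁻²` the bridge class is unbounded in `L` for every `T ≥ 1`.
[cite: BeatonBousquetMelouDeGierDuminilCopinGuttmann2014, proof of Proposition 5 (arXiv v5 p. 9)] -/
def StripByUnboundedLarge : Prop :=
  ∀ (T : ℕ) (y : ℝ), 1 ≤ T → 2 + Real.sqrt 2 < y → ¬ BddAbove (Set.range fun L : ℕ => stripGFy T L (IsBetaDart T) y)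

/-- UB′ holds. [cite: BeatonBousquetMelouDeGierDuminilCopinGuttmann2014, proof of Proposition 5 (arXiv v5 p. 9)] -/
theorem stripByUnboundedLarge_holds : StripByUnboundedLarge := fun _ _ hT hy => stripGFy_beta_not_bddAbove hT hy

end Literature.Probability.RandomPlanarGeometry.SAW.HV
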